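import Summits.CriticalPhenomena.PercolationContinuityZ3.Theorems.PercNearOneGluingNoHeavyQuantGatedSliceMixLawC3
import HarnessLib

/-!
# QUANT lane R8, T-DEC, leg (III), blob case — `LawDec.GatedSliceMixLaw'`, REGIME C4 PROVED: the twin `k₁ + a` of the low `k₁` is a mid
# ABOVE the target and saturated by `k₁`, `k₂` a giant, both atoms of the weak-mid law at most `j` — `k₁` fills its twin first, the rest rides
# `W`'s mids; `usage(k₁, k₁+a)(k₁ + a − t) ≤ t − k₁` turns the twin's consumption into income and the zero inequality is regime C1's

builds on p205010 (kernel theorem, internal audit signed; external expert review pending)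

Support file (`--supports stmt-CriticalPhenomena-4575`), QUANT lane typer seat prim-quant-stmt (gen 30), rung R8 of
`run/shared/lean/prim/quant/LADDER.md`.  Memo `run/shared/lean/prim/quant/prim-quant-stmt-g30/MIXLAW-MIXTURES-G30.md` §6 (L).  Theorems only,
standard axioms, no sorries.  Tools: `…QuantGatedSliceMixLawExchange`, `…WSide`, `…C3` (`zero_ineq_of_TA`).

THE REGIME (class LMGGMM of the seat's census; rare among genuine instances, 1 in 6 000 targeted).  Frame of `GatedSliceMixLaw'`; `2k₁ < t`,
`k₁ + a ≤ j` with `k₁ + a > t` (the twin is a zero-compatible mid, compatible with `k₁`); SATURATION `m₁' ≤ m₁·usage(k₁, k₁+a)` (the twin cannot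
absorb all of `k₁`; when it can, no nonzero low is left over — a `θ = 0` cell of the Q-alone side); `k₂ ≥ j+1`; `h + a ≤ j`, `2h ≥ t`.
Certificate: `k₁ → twin` exactly filling it (`β = m₁'/usage`), `k₁' = m₁ − β → W`'s mids at the balance point `ρ = k₁'/K_{k₁}`, zeros → giants;
inequality `y(z + ρw₀) ≤ (1−y)(1−z)λ` via `k₁'(t−k₁) ≤ m₁(t−k₁) + m₁'(t − k₁ − a)` (`usage_mid_mul_le`) and `zero_ineq_of_TA`.  Exact census: 0 failures
(certL2.py, plan PL2); `W_h ∉ D` not needed.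

* **`LawDec.gatedSliceMixLaw_regimeC4`** — the conclusion of `GatedSliceMixLaw'` in regime C4.

[this work]; exchange architecture: this seat (gen 30); usage bounds: prim-quant-stmt g26 (this lane).  Nothing here is cited as a published
result.  The gluing rows served [cite: KozmaNitzan2024, Conjecture 3 (p. 15)]; product measure [cite: Grimmett1999, §1.3 p. 10].
-/

noncomputable section

namespace Summit.CriticalPhenomena.PercolationContinuityZ3.Theorems

namespace Quant

open Finset

/-- the two-point law `{lo, hi; g}` (as in `…QuantLawDEC`) -/
local notation3 "TP[" lo ", " hi ", " g ", " h "]" =>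
  (g : ℝ) * (if (h : ℕ) = (hi : ℕ) then (1 : ℝ) else 0) + (1 - (g : ℝ)) * (if (h : ℕ) = (lo : ℕ) then (1 : ℝ) else 0)

namespace LawDec

/-! ### Regime C4: the twin above the target, saturated by the low -/

set_option maxHeartbeats 800000 in
/-- **`GatedSliceMixLaw'` IN REGIME C4** (`2k₁ < t`; the twin `k₁ + a ≤ j` with `k₁ + a > t`; saturation `m₁' ≤ m₁·usage(k₁, k₁+a)`;
`k₂ ≥ j+1`; `h + a ≤ j`, `2h ≥ t`): the conclusion of `GatedSliceMixLaw'` (`W_h ∉ D` not needed).  The low `k₁` fills its twin first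
(`β = m₁'/usage(k₁,k₁+a)`), the rest rides `W`'s mids, the zeros ride the giants; `usage(k₁, k₁+a)(k₁ + a − t) ≤ t − k₁` turns the twin's
consumption into income and the zero inequality is regime C1's. [this work] -/
theorem gatedSliceMixLaw_regimeC4 (y z g S lam : ℝ) (a j M h k₁ k₂ : ℕ)
    (hy0 : 0 < y) (hy1 : y < 1) (hz0 : 0 ≤ z) (hz1 : z < 1) (hg1 : g ≤ 1) (hyg : y ≤ (1 - z) * g)
    (hS0 : 0 < S) (hta : y * (M : ℝ) ≤ S) (hhM : h ≤ M) (hSh : S < (h : ℝ))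
    (hk : k₁ ≤ k₂) (hk₂M : k₂ ≤ M) (hlam0 : 0 ≤ lam) (hlam1 : lam ≤ 1)
    (hmean : (1 - z) * ((k₁ : ℝ) + ((k₂ : ℝ) - k₁) * lam) = S)
    (hk1low : 2 * (k₁ : ℝ) < S + (a : ℝ) * g * (1 - z)) (hlj : k₁ + a ≤ j)
    (hlt : S + (a : ℝ) * g * (1 - z) < ((k₁ + a : ℕ) : ℝ))
    (hsat : (1 - z) * (1 - lam) * g ≤ (1 - z) * (1 - lam) * (1 - g) * usage y (S + (a : ℝ) * g * (1 - z)) j k₁ (k₁ + a))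
    (hk₂G : j + 1 ≤ k₂) (hhaj : h + a ≤ j) (hhmid : S + (a : ℝ) * g * (1 - z) ≤ 2 * (h : ℝ)) :
    ∃ θ : ℝ, 0 ≤ θ ∧ θ < 1 ∧
      DECAtT y (S + (a : ℝ) * g * (1 - z)) j (M + a)
        (fun p => θ * weakMidLaw S g h a p
          + (1 - θ) * (z * (if p = 0 then (1 : ℝ) else 0) + (1 - z) * slice (fun q => TP[k₁, k₂, lam, q]) a g p)) := by
  classical
  set t : ℝ := S + (a : ℝ) * g * (1 - z) with ht
  have h1z : 0 < 1 - z := by linarith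
  have hg0 : 0 < g := by nlinarith
  have h1y : 0 < 1 - y := by linarith
  have ha0 : (0 : ℝ) ≤ a := Nat.cast_nonneg a
  have hh0 : (0 : ℝ) < h := lt_trans hS0 hSh
  have hk₁0 : (0 : ℝ) ≤ k₁ := Nat.cast_nonneg k₁
  have hSh' : 0 < S / (h : ℝ) := div_pos hS0 hh0
  have hw0 : 0 ≤ 1 - S / (h : ℝ) := by rw [sub_nonneg, div_le_one hh0]; exact hSh.le
  have h1lam : 0 ≤ 1 - lam := by linarith
  have hyk₂ : y * (k₂ : ℝ) ≤ S := le_trans (mul_le_mul_of_nonneg_left (by exact_mod_cast hk₂M) hy0.le) hta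
  have htaN : ∀ p : ℕ, p ≤ M + a → y * (p : ℝ) ≤ t := by
    intro p hp
    have : (p : ℝ) ≤ ((M + a : ℕ) : ℝ) := by exact_mod_cast hp
    push_cast at this; rw [ht]; nlinarith [mul_nonneg ha0 hg0.le]
  have htaha : y * ((h + a : ℕ) : ℝ) ≤ t := htaN (h + a) (by omega)
  have htal : y * ((k₁ + a : ℕ) : ℝ) ≤ t := htaN (k₁ + a) (by omega)
  set m₁ : ℝ := (1 - z) * (1 - lam) * (1 - g) with hm₁
  set m₁' : ℝ := (1 - z) * (1 - lam) * g with hm₁'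
  have hm₁0 : 0 ≤ m₁ := mul_nonneg (mul_nonneg h1z.le h1lam) (by linarith)
  have hm₁'0 : 0 ≤ m₁' := mul_nonneg (mul_nonneg h1z.le h1lam) hg0.le
  have hm₂0 : 0 ≤ (1 - z) * lam * (1 - g) := mul_nonneg (mul_nonneg h1z.le hlam0) (by linarith)
  have hm₂'0 : 0 ≤ (1 - z) * lam * g := mul_nonneg (mul_nonneg h1z.le hlam0) hg0.le
  -- the twin, saturated by k₁
  set Ut : ℝ := usage y t j k₁ (k₁ + a) with hUt
  have hcompt : t < (k₁ : ℝ) + ((k₁ + a : ℕ) : ℝ) := by linarith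
  have hk₁lt : k₁ < k₁ + a := by
    have : (k₁ : ℝ) < ((k₁ + a : ℕ) : ℝ) := by linarith
    exact_mod_cast this
  have hUtpos : 0 < Ut := usage_pos_of_compat y t j k₁ (k₁ + a) hy0 hy1 hk1low hk₁lt (Or.inr hcompt)
  set β : ℝ := m₁' / Ut with hβ
  have hβ0 : 0 ≤ β := div_nonneg hm₁'0 hUtpos.le
  have hβU : Ut * β = m₁' := by rw [hβ]; field_simp
  set k₁' : ℝ := m₁ - β with hk₁'
  have hk₁'0 : 0 ≤ k₁' := by rw [hk₁', hβ, sub_nonneg, div_le_iff₀ hUtpos]; exact hsat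
  -- capacity of the donor k₁ in W's mids
  obtain ⟨K₁, hK₁⟩ : ∃ K : ℝ, K = (if t < (k₁ : ℝ) + h then S / h * (1 - g) / usage y t j k₁ h else 0)
      + S / h * g / usage y t j k₁ (h + a) := ⟨_, rfl⟩
  have hK₁ge := weakMid_capacity_ge y t S g z j h a k₁ hy0 hy1 hg0.le hg1 hz0 hS0.le hSh ht hk1low hhaj htaha
  rw [← hK₁] at hK₁ge
  have htk₁ : 0 < t - k₁ := by linarith
  have hc0 : 0 < S / h * ((h : ℝ) - S) := mul_pos hSh' (by linarith)
  have hK₁pos : 0 < K₁ := lt_of_lt_of_le (div_pos hc0 htk₁) hK₁ge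
  -- balance point
  obtain ⟨ρ, hρ⟩ : ∃ r : ℝ, r = k₁' / K₁ := ⟨_, rfl⟩
  have hρ0 : 0 ≤ ρ := by rw [hρ]; exact div_nonneg hk₁'0 hK₁pos.le
  obtain ⟨θ, hθ⟩ : ∃ q : ℝ, q = ρ / (1 + ρ) := ⟨_, rfl⟩
  have hθ0 : 0 ≤ θ := by rw [hθ]; exact div_nonneg hρ0 (by linarith)
  have hθ1 : θ < 1 := by rw [hθ, div_lt_one (by linarith)]; linarith
  have h1θ : 0 < 1 - θ := by linarith
  have hθρ : θ = (1 - θ) * ρ := by rw [hθ]; field_simp; ring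
  have hK₁ne : K₁ ≠ 0 := hK₁pos.ne'
  have hρK : ρ * K₁ = k₁' := by rw [hρ]; field_simp
  have hθK : θ * K₁ = (1 - θ) * k₁' := by linear_combination K₁ * hθρ + (1 - θ) * hρK
  -- W-side
  have hhaN : h + a ≤ M + a := by omega
  have hcomp1 : t < (k₁ : ℝ) + ((h + a : ℕ) : ℝ) := by
    push_cast; have : (a : ℝ) * g * (1 - z) ≤ a := by nlinarith [mul_nonneg ha0 hg0.le]
    rw [ht]; linarith
  have hk₁j : k₁ ≤ j := by omega
  have W1 := flowAtT_weakMidShare y t S g θ j (M + a) h a k₁ hy0 hy1 hg0.le hg1 hS0.le hθ0 hk₁j hk1low hhaN hhmid hcomp1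
  rw [← hK₁] at W1
  -- THE inequality
  have hineq : y / (1 - y) * (z + ρ * (1 - S / h)) ≤ (1 - z) * lam := by
    have hb1 : ρ ≤ k₁' * (t - k₁) / (S / h * ((h : ℝ) - S)) := by
      rw [hρ, div_le_div_iff₀ hK₁pos hc0]
      have h1 : S / h * ((h : ℝ) - S) ≤ K₁ * (t - k₁) := (div_le_iff₀ htk₁).1 hK₁ge
      calc k₁' * (S / h * ((h : ℝ) - S)) ≤ k₁' * (K₁ * (t - k₁)) := mul_le_mul_of_nonneg_left h1 hk₁'0
        _ = k₁' * (t - k₁) * K₁ := by ring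
    have hne1 : (h : ℝ) ≠ 0 := hh0.ne'
    have hne2 : (h : ℝ) - S ≠ 0 := by intro h0; linarith
    have hne3 : S ≠ 0 := hS0.ne'
    have hρle : ρ * (1 - S / h) ≤ k₁' * (t - k₁) / S := by
      have e : k₁' * (t - k₁) / (S / h * ((h : ℝ) - S)) * (1 - S / h) = k₁' * (t - k₁) / S := by
        rw [show (1 : ℝ) - S / h = ((h : ℝ) - S) / h by field_simp]
        field_simp
      calc ρ * (1 - S / h) ≤ k₁' * (t - k₁) / (S / h * ((h : ℝ) - S)) * (1 - S / h) := mul_le_mul_of_nonneg_right hb1 hw0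
        _ = _ := e
    -- the twin's consumption is income: β (t − k₁) ≥ m₁' (ℓ − t)
    have hsave : m₁' * (((k₁ + a : ℕ) : ℝ) - t) ≤ β * (t - k₁) := by
      have hU := usage_mid_mul_le y t j k₁ (k₁ + a) hy0 hy1 hk1low hlj hcompt htal
      rw [← hUt] at hU
      calc m₁' * (((k₁ + a : ℕ) : ℝ) - t) = β * (Ut * (((k₁ + a : ℕ) : ℝ) - t)) := by rw [← hβU]; ring
        _ ≤ β * (t - k₁) := mul_le_mul_of_nonneg_left hU hβ0
    have hinc : k₁' * (t - k₁) ≤ (1 - z) * (1 - lam) * (S - k₁ - (a : ℝ) * g * z) := by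
      have e : (1 - z) * (1 - lam) * (S - k₁ - (a : ℝ) * g * z) = m₁ * (t - k₁) + m₁' * (t - ((k₁ + a : ℕ) : ℝ)) := by
        simp only [hm₁, hm₁']; push_cast; rw [ht]; ring
      have e2 : k₁' * (t - k₁) = m₁ * (t - k₁) - β * (t - k₁) := by rw [hk₁']; ring
      rw [e, e2]
      linarith [hsave]
    rw [div_mul_eq_mul_div, div_le_iff₀ h1y]
    have key := zero_ineq_of_TA y z g S lam a k₁ k₂ hy0.le hz0 hz1 hg0.le hlam0 hlam1 hS0 hmean hyk₂
    calc y * (z + ρ * (1 - S / h)) ≤ y * (z + (1 - z) * (1 - lam) * (S - k₁ - (a : ℝ) * g * z) / S) := by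
          refine mul_le_mul_of_nonneg_left ?_ hy0.le
          have := div_le_div_of_nonneg_right hinc hS0.le
          linarith
      _ ≤ (1 - z) * lam * (1 - y) := key
  -- P-side: the pair (k₁, twin) and the zeros on the giants
  have hlmid : t ≤ 2 * ((k₁ + a : ℕ) : ℝ) := by
    have : (0 : ℝ) ≤ ((k₁ + a : ℕ) : ℝ) := Nat.cast_nonneg _
    linarith
  have Ptwin := flowAtT_pair y t j (M + a) k₁ (k₁ + a) ((1 - θ) * β) ((1 - θ) * m₁') hk₁j hk1low (by omega) (Or.inr hlmid)
    (Or.inr hcompt) (mul_nonneg h1θ.le hβ0) (le_of_eq (by rw [← hβU, ← hUt]; ring))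
  have Pg : FlowAtT y t j (M + a) (fun p => (θ * (1 - S / h) + (1 - θ) * z) * (if p = 0 then (1 : ℝ) else 0)
      + (1 - θ) * ((1 - z) * lam * (1 - g)) * (if p = k₂ then (1 : ℝ) else 0)
      + (1 - θ) * ((1 - z) * lam * g) * (if p = k₂ + a then (1 : ℝ) else 0)) := by
    have hz' : 0 ≤ θ * (1 - S / h) + (1 - θ) * z := add_nonneg (mul_nonneg hθ0 hw0) (mul_nonneg h1θ.le hz0)
    refine flowAtT_of_giants y t j (M + a) _ hy0 hy1 (fun p => ?_) ?_
    · refine add_nonneg (add_nonneg (mul_nonneg hz' ?_) (mul_nonneg (mul_nonneg h1θ.le hm₂0) ?_))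
        (mul_nonneg (mul_nonneg h1θ.le hm₂'0) ?_) <;> split_ifs <;> norm_num
    · have hl : ∑ l ∈ Finset.range (j + 1), (if 2 * (l : ℝ) < t then
          (θ * (1 - S / h) + (1 - θ) * z) * (if l = 0 then (1 : ℝ) else 0)
            + (1 - θ) * ((1 - z) * lam * (1 - g)) * (if l = k₂ then (1 : ℝ) else 0)
            + (1 - θ) * ((1 - z) * lam * g) * (if l = k₂ + a then (1 : ℝ) else 0) else 0)
          = θ * (1 - S / h) + (1 - θ) * z := by
        have e : ∀ l ∈ Finset.range (j + 1), (if 2 * (l : ℝ) < t then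
            (θ * (1 - S / h) + (1 - θ) * z) * (if l = 0 then (1 : ℝ) else 0)
              + (1 - θ) * ((1 - z) * lam * (1 - g)) * (if l = k₂ then (1 : ℝ) else 0)
              + (1 - θ) * ((1 - z) * lam * g) * (if l = k₂ + a then (1 : ℝ) else 0) else 0)
            = (θ * (1 - S / h) + (1 - θ) * z) * (if l = 0 then (1 : ℝ) else 0) := by
          intro l hl
          have hl' : l ≤ j := Nat.lt_succ_iff.1 (Finset.mem_range.1 hl)
          rw [if_neg (show l ≠ k₂ by omega), if_neg (show l ≠ k₂ + a by omega)]
          by_cases hl0 : l = 0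
          · subst hl0; rw [if_pos (by push_cast; linarith)]; ring
          · rw [if_neg hl0]; split_ifs <;> ring
        rw [Finset.sum_congr rfl e]
        exact sum_mul_indicator (fun _ => θ * (1 - S / h) + (1 - θ) * z) j 0 (by omega)
      have hg' : ∑ p ∈ Finset.Ico (j + 1) (M + a + 1),
          ((θ * (1 - S / h) + (1 - θ) * z) * (if p = 0 then (1 : ℝ) else 0)
            + (1 - θ) * ((1 - z) * lam * (1 - g)) * (if p = k₂ then (1 : ℝ) else 0)
            + (1 - θ) * ((1 - z) * lam * g) * (if p = k₂ + a then (1 : ℝ) else 0)) = (1 - θ) * ((1 - z) * lam) := by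
        have e : ∀ p ∈ Finset.Ico (j + 1) (M + a + 1),
            ((θ * (1 - S / h) + (1 - θ) * z) * (if p = 0 then (1 : ℝ) else 0)
              + (1 - θ) * ((1 - z) * lam * (1 - g)) * (if p = k₂ then (1 : ℝ) else 0)
              + (1 - θ) * ((1 - z) * lam * g) * (if p = k₂ + a then (1 : ℝ) else 0))
              = (1 - θ) * ((1 - z) * lam * (1 - g)) * (if p = k₂ then (1 : ℝ) else 0)
                + (1 - θ) * ((1 - z) * lam * g) * (if p = k₂ + a then (1 : ℝ) else 0) := by
          intro p hp
          have : p ≠ 0 := by have := (Finset.mem_Ico.1 hp).1; omega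
          rw [if_neg this]; ring
        rw [Finset.sum_congr rfl e, Finset.sum_add_distrib, ← Finset.mul_sum, ← Finset.mul_sum,
          Finset.sum_ite_eq' (Finset.Ico (j + 1) (M + a + 1)) k₂, Finset.sum_ite_eq' (Finset.Ico (j + 1) (M + a + 1)) (k₂ + a),
          if_pos (Finset.mem_Ico.2 ⟨hk₂G, by omega⟩), if_pos (Finset.mem_Ico.2 ⟨by omega, by omega⟩)]
        ring
      rw [hl, hg']
      have e1 : θ * (1 - S / h) + (1 - θ) * z = (1 - θ) * (z + ρ * (1 - S / h)) := by linear_combination (1 - S / h) * hθρ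
      rw [e1, show y / (1 - y) * ((1 - θ) * (z + ρ * (1 - S / h))) = (1 - θ) * (y / (1 - y) * (z + ρ * (1 - S / h))) by ring]
      exact mul_le_mul_of_nonneg_left hineq h1θ.le
  -- assemble
  have hsumflow := FlowAtT.add W1 (FlowAtT.add Ptwin Pg)
  have hflow : FlowAtT y t j (M + a) (fun p => θ * weakMidLaw S g h a p
      + (1 - θ) * (z * (if p = 0 then (1 : ℝ) else 0) + (1 - z) * slice (fun q => TP[k₁, k₂, lam, q]) a g p)) := by
    refine (congrArg (FlowAtT y t j (M + a)) (funext fun p => ?_)).mp hsumflow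
    rw [movedTwoPoint_apply, ← hm₁, ← hm₁']
    unfold weakMidLaw
    have e1 : (1 - θ) * m₁ = θ * K₁ + (1 - θ) * β := by rw [hθK, hk₁']; ring
    linear_combination (-(if p = k₁ then (1 : ℝ) else 0)) * e1
  exact gatedSliceMixLaw_conclusion_of_flowAtT y z g S lam θ a j M h k₁ k₂ hy0 hy1 hhM hk hk₂M hθ0 hθ1 hflow

end LawDec

end Quant

end Summit.CriticalPhenomena.PercolationContinuityZ3.Theorems
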